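import Summits.AtomisticToContinuum.Crystallization.Theorems.FrustratedLawDichotomyCellF1Frame

/-!
# FrustratedLawDichotomy · crux `AperiodicFrustratedLawGap` (stmt-AtomisticToContinuum-27623) — class-A K-file skeleton, layer 2:
the F1 LABEL SET, list-backed (decomp-a2c hand-2 g47, structural share; KFILE-FORMAT ed2+A+B §3′ `Cell_<id>_Labels`, mechanics
LABELS-SCALE (b) of record, crit r1809)

The 14 065 labels of the F1 cell are ENUMERATED IN THE KERNEL, never written as a literal: `boxF1 a b` = the integer box `[-a,a] × [-b,b]²`
(nested `flatMap`, the shape that evaluates), `labF1 := (boxF1 20 18).filter admLF` (parity ∧ `qk ≤ BL`, with the class key in CLOSED FORM `qkF` —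
the `Matrix.mulVec` form costs ×4 in the kernel), `intF1 := (boxF1 6 5).filter admIF` (the 403 interior labels).  Dictionary BY PREDICATE (`mem_labF1 : m ∈ labF1 ↔ admL m`, through the cube bound of layer 1 — no list search), structural
`Nodup` (injectivity of the enumeration, O(0) kernel), and the `Finset` façade the doors (251)/(260) speak: `MF1 := labF1.toFinset`, `MIF1 :=
intF1.toFinset`, both IRREDUCIBLE for the elaborator (equation lemmas give the membership/sum bridges) (hand-2 KERNEL-MUST: a 14k-element computable
`Finset` is never `whnf`'d), with `mem_M`/`mem_MI`, `MIF1 ⊆ MF1`, `0 ∈ MIF1`, the closures `MF1·act = MF1` / `MIF1·act = MIF1` under all sixteen elements of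
`Stab16` (from `admL_act`/`admI_act` — closure by predicate), the door hypotheses that are per-label but list-free (parity, window, interior,
★ separation via `sep_F1`), and the `Σ_{m ∈ MF1} = List.sum` / `∀ m ∈ MF1 = List.all` bridges every later K-file fold uses.  Kernel facts decided
here, with their measured cost: `labF1.length = 14065`, `intF1.length = 403` (census N9′-F1-54 ✓).
-/

namespace Summit.AtomisticToContinuum.Crystallization.Theorems.FrustratedLawDichotomyCellF1Labels

open scoped BigOperators
open Summit.AtomisticToContinuum.Crystallization.Theorems.FrustratedLawDichotomyCellMetric (posL)
open Summit.AtomisticToContinuum.Crystallization.Theorems.FrustratedLawDichotomyCellTriples (zT sumT)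
open Summit.AtomisticToContinuum.Crystallization.Theorems.FrustratedLawDichotomyCellSymmZ3 (actZ)
open Summit.AtomisticToContinuum.Crystallization.Theorems.FrustratedLawDichotomyCellStab16 (RZ Rr image_eq)
open Summit.AtomisticToContinuum.Crystallization.Theorems.FrustratedLawDichotomyCellF1Frame

/-! ## §1 The enumeration -/

/-- the integer range `[-R, R]` as a list. -/
def rngF1 (R : ℕ) : List ℤ := (List.range (2 * R + 1)).map fun n : ℕ => (n : ℤ) - R

/-- the integer box `[-a, a] × [-b, b] × [-b, b]` (nested `flatMap`, the shape that evaluates in the kernel); labels live in `boxF1 20 18`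
(68 921 candidates), interior labels in `boxF1 6 5` (1 573 candidates). -/
def boxF1 (a b : ℕ) : List (ℤ × ℤ × ℤ) :=
  (rngF1 a).flatMap fun i => (rngF1 b).flatMap fun j => (rngF1 b).map fun k => (i, j, k)

/-- the class key in closed form (kernel-cheap: three products, no `Matrix.mulVec`/`Finset.sum` unfolding per candidate). -/
def qkF (m : ℤ × ℤ × ℤ) : ℤ := 109767529 * (m.1 * m.1) + 137030436 * (m.2.1 * m.2.1 + m.2.2 * m.2.2)

/-- it is the class key of layer 1. -/
theorem qkF_eq (m : ℤ × ℤ × ℤ) : qkF m = qk m := (qk_eq m).symm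

/-- label admissibility, kernel-cheap form. -/
def admLF (m : ℤ × ℤ × ℤ) : Bool := (sumT m % 2 == 0) && decide (qkF m ≤ BL)

/-- interior admissibility, kernel-cheap form. -/
def admIF (m : ℤ × ℤ × ℤ) : Bool := (sumT m % 2 == 0) && decide (qkF m ≤ BI)

/-- the kernel-cheap predicate IS layer 1's `admL`. -/
theorem admLF_eq (m : ℤ × ℤ × ℤ) : admLF m = admL m := by
  unfold admLF admL; rw [qkF_eq]

/-- the kernel-cheap predicate IS layer 1's `admI`. -/
theorem admIF_eq (m : ℤ × ℤ × ℤ) : admIF m = admI m := by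
  unfold admIF admI; rw [qkF_eq]

/-- ★ the F1 labels: admissible box points (census's 14 065). -/
def labF1 : List (ℤ × ℤ × ℤ) := (boxF1 20 18).filter admLF

/-- the F1 interior labels (census's 403). -/
def intF1 : List (ℤ × ℤ × ℤ) := (boxF1 6 5).filter admIF

/-- membership in the range list. -/
theorem mem_rngF1 {R : ℕ} {a : ℤ} : a ∈ rngF1 R ↔ |a| ≤ R := by
  rw [abs_le]
  simp only [rngF1, List.mem_map, List.mem_range]
  constructor
  · rintro ⟨n, hn, rfl⟩; omega
  · rintro ⟨h1, h2⟩; exact ⟨(a + R).toNat, by omega, by omega⟩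

/-- the range list has no duplicates. -/
theorem rngF1_nodup (R : ℕ) : (rngF1 R).Nodup := (List.nodup_range).map fun x y h => by simpa using h

/-- membership in the box, by coordinates. -/
theorem mem_boxF1 {a b : ℕ} {m : ℤ × ℤ × ℤ} : m ∈ boxF1 a b ↔ |m.1| ≤ a ∧ |m.2.1| ≤ b ∧ |m.2.2| ≤ b := by
  obtain ⟨i, j, k⟩ := m
  simp only [boxF1, List.mem_flatMap, List.mem_map, mem_rngF1, Prod.mk.injEq]
  constructor
  · rintro ⟨i', hi, j', hj, k', hk, rfl, rfl, rfl⟩; exact ⟨hi, hj, hk⟩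
  · rintro ⟨hi, hj, hk⟩; exact ⟨i, hi, j, hj, k, hk, rfl, rfl, rfl⟩

/-- ★ membership of a label BY PREDICATE (the cube bound of layer 1 discharges the box). -/
theorem mem_labF1 {m : ℤ × ℤ × ℤ} : m ∈ labF1 ↔ admL m = true := by
  simp only [labF1, List.mem_filter, mem_boxF1, admLF_eq]
  constructor
  · exact fun h => h.2
  · intro h
    have hq := ((admL_iff m).mp h).2
    have hc := cube_of_qk_le hq
    exact ⟨⟨by exact_mod_cast hc.1, by exact_mod_cast hc.2.1, by exact_mod_cast hc.2.2⟩, h⟩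

/-- membership of an interior label by predicate. -/
theorem mem_intF1 {m : ℤ × ℤ × ℤ} : m ∈ intF1 ↔ admI m = true := by
  simp only [intF1, List.mem_filter, mem_boxF1, admIF_eq]
  constructor
  · exact fun h => h.2
  · intro h
    have hq := ((admI_iff m).mp h).2
    have hc := cube_of_qk_le_BI hq
    exact ⟨⟨by exact_mod_cast hc.1, by exact_mod_cast hc.2.1, by exact_mod_cast hc.2.2⟩, h⟩

/-- the box enumeration has no duplicates (structural: injectivity of the generators; no kernel work). -/
theorem boxF1_nodup (a b : ℕ) : (boxF1 a b).Nodup := by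
  unfold boxF1
  rw [List.nodup_flatMap]
  refine ⟨fun i _ => ?_, ?_⟩
  · rw [List.nodup_flatMap]
    refine ⟨fun j _ => (rngF1_nodup b).map fun k k' h => by simpa using h, ?_⟩
    refine (rngF1_nodup b).pairwise_of_forall_ne fun j _ j' _ hne => ?_
    simp only [Function.onFun, List.disjoint_left, List.mem_map]
    rintro _ ⟨k, -, rfl⟩ ⟨k', -, h⟩
    simp only [Prod.mk.injEq] at h
    exact hne h.2.1.symm
  · refine (rngF1_nodup a).pairwise_of_forall_ne fun i _ i' _ hne => ?_
    simp only [Function.onFun, List.disjoint_left, List.mem_flatMap, List.mem_map]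
    rintro _ ⟨j, -, k, -, rfl⟩ ⟨j', -, k', -, h⟩
    simp only [Prod.mk.injEq] at h
    exact hne h.1.symm

/-- the label list has no duplicates. -/
theorem labF1_nodup : labF1.Nodup := (boxF1_nodup 20 18).filter _

/-- the interior list has no duplicates. -/
theorem intF1_nodup : intF1.Nodup := (boxF1_nodup 6 5).filter _

/-! ## §2 The `Finset` façade (never evaluated) -/

/-- the label set `MF1` of the F1 cell (IRREDUCIBLE for the elaborator: a 14k-element computable `Finset` is never `whnf`'d — hand-2
KERNEL-MUST, C15Template precedent; every use goes through the lemmas below, the kernel is unaffected). -/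
@[irreducible] def MF1 : Finset (ℤ × ℤ × ℤ) := labF1.toFinset

/-- the interior label set `MIF1` of the F1 cell (irreducible likewise). -/
@[irreducible] def MIF1 : Finset (ℤ × ℤ × ℤ) := intF1.toFinset

/-- membership in `MF1` by predicate. -/
theorem mem_M {m : ℤ × ℤ × ℤ} : m ∈ MF1 ↔ admL m = true := by rw [MF1, List.mem_toFinset, mem_labF1]

/-- membership in `MIF1` by predicate. -/
theorem mem_MI {m : ℤ × ℤ × ℤ} : m ∈ MIF1 ↔ admI m = true := by rw [MIF1, List.mem_toFinset, mem_intF1]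

/-- `Σ_{m ∈ MF1}` is a list sum (the bridge every K-file fold uses). -/
theorem sum_M {β : Type*} [AddCommMonoid β] (f : ℤ × ℤ × ℤ → β) : ∑ m ∈ MF1, f m = (labF1.map f).sum := by
  rw [MF1, List.sum_toFinset _ labF1_nodup]

/-- `Σ_{m ∈ MIF1}` is a list sum. -/
theorem sum_MI {β : Type*} [AddCommMonoid β] (f : ℤ × ℤ × ℤ → β) : ∑ m ∈ MIF1, f m = (intF1.map f).sum := by
  rw [MIF1, List.sum_toFinset _ intF1_nodup]

/-- `∀ m ∈ MF1` is a list fact. -/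
theorem forall_M {P : ℤ × ℤ × ℤ → Prop} : (∀ m ∈ MF1, P m) ↔ ∀ m ∈ labF1, P m := by
  simp only [MF1, List.mem_toFinset]

/-- `∀ m ∈ MIF1` is a list fact. -/
theorem forall_MI {P : ℤ × ℤ × ℤ → Prop} : (∀ m ∈ MIF1, P m) ↔ ∀ m ∈ intF1, P m := by
  simp only [MIF1, List.mem_toFinset]

/-- a filter of `MF1` is the filtered list (sub-lists `ML`/`MN`/`nb` of the doors are `ballL MF1 zT ℓ c = MF1.filter …`). -/
theorem filter_M (p : ℤ × ℤ × ℤ → Prop) [DecidablePred p] : MF1.filter p = (labF1.filter fun m => decide (p m)).toFinset := by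
  rw [MF1, List.toFinset_filter]
  exact Finset.filter_congr fun x _ => by simp

/-- the root is an interior label. -/
theorem zero_mem_MI : (0 : ℤ × ℤ × ℤ) ∈ MIF1 := mem_MI.mpr admI_zero

/-- interior labels are labels. -/
theorem MI_subset_M : MIF1 ⊆ MF1 := fun _ hm => mem_M.mpr (admL_of_admI (mem_MI.mp hm))

/-- the root is a label. -/
theorem zero_mem_M : (0 : ℤ × ℤ × ℤ) ∈ MF1 := MI_subset_M zero_mem_MI

/-! ## §3 Closure under `Stab16` (by predicate) and the list-free door hypotheses -/

/-- `MF1` is closed under every element of `Stab16`. -/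
theorem M_act_mem (k : Fin 16) : ∀ x ∈ MF1, actZ (RZ k) x ∈ MF1 := fun x hx => mem_M.mpr (by rw [admL_act]; exact mem_M.mp hx)

/-- `MIF1` is closed under every element of `Stab16`. -/
theorem MI_act_mem (k : Fin 16) : ∀ x ∈ MIF1, actZ (RZ k) x ∈ MIF1 := fun x hx => mem_MI.mpr (by rw [admI_act]; exact mem_MI.mp hx)

/-- (hM) `MF1·act = MF1`. -/
theorem hM (k : Fin 16) : MF1.image (actZ (RZ k)) = MF1 := image_eq k (M_act_mem k)

/-- (hMI) `MIF1·act = MIF1`. -/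
theorem hMI (k : Fin 16) : MIF1.image (actZ (RZ k)) = MIF1 := image_eq k (MI_act_mem k)

/-- every label is a parity label. -/
theorem hpar : ∀ m ∈ MF1, Even (sumT m) := fun m hm => ((admL_iff m).mp (mem_M.mp hm)).1

/-- (hwin) every label sits inside the window with the strain slack: `(1 + 3ε)·Σᵢ(T·z)ᵢ² ≤ (Rc − τ)²`. -/
theorem hwin : ∀ m ∈ MF1, (1 + 3 * (1 / 1024 : ℝ)) * ∑ i, (T.mulVec (fun j => (zT m j : ℝ)) i) ^ 2 ≤ (13 - 1 / 1024) ^ 2 :=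
  fun m hm => window_of_admL ((admL_iff m).mp (mem_M.mp hm)).2

/-- (hint) every interior label satisfies `(1 + 3ε)·Σᵢ(T·z)ᵢ² ≤ R_A²`. -/
theorem hint : ∀ m ∈ MIF1, (1 + 3 * (1 / 1024 : ℝ)) * ∑ i, (T.mulVec (fun j => (zT m j : ℝ)) i) ^ 2 ≤ 4 ^ 2 :=
  fun m hm => interior_of_admI ((admI_iff m).mp (mem_MI.mp hm)).2

/-- ★ (hsep) the strained template is `7/10`-separated on `MF1` for every `F` of the strain cell — no list work. -/
theorem hsep {F : Matrix (Fin 3) (Fin 3) ℝ} (hG : ∀ i j, |(F.transpose * F) i j - (if i = j then 1 else 0)| ≤ 1 / 1024) :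
    ∀ z ∈ MF1, ∀ z' ∈ MF1, z ≠ z' →
      (7 / 10 : ℝ) ≤ dist (posL F (T.mulVec fun j => (zT z j : ℝ))) (posL F (T.mulVec fun j => (zT z' j : ℝ))) :=
  fun z hz z' hz' hne => sep_F1 hG (hpar z hz) (hpar z' hz') hne

/-! ## §4 Kernel facts (census N9′-F1-54 counts; measured enumeration cost) -/

/-- ★ the F1 cell has exactly `14 065` labels. -/
theorem labF1_length : labF1.length = 14065 := by decide +kernel

/-- the F1 cell has exactly `403` interior labels. -/
theorem intF1_length : intF1.length = 403 := by decide +kernel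

/-- `|MF1| = 14 065`. -/
theorem card_M : MF1.card = 14065 := by rw [MF1, List.toFinset_card_of_nodup labF1_nodup, labF1_length]

/-- `|MIF1| = 403`. -/
theorem card_MI : MIF1.card = 403 := by rw [MIF1, List.toFinset_card_of_nodup intF1_nodup, intF1_length]

end Summit.AtomisticToContinuum.Crystallization.Theorems.FrustratedLawDichotomyCellF1Labels
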